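import Literature.Probability.Percolation.ArmSeparationInCoverFour
import Literature.Probability.Percolation.ArmSeparationInExtFour
import Literature.Probability.Percolation.ArmSeparationSepInitFour
import Literature.Probability.Percolation.ArmSeparationInScheme
import HarnessLib

/-!
# The internal half of the near-critical four-arm separation theorem, at `p`

Topic `Literature/Probability/Percolation`; family `crit-perc` / near-critical percolation on `𝕋`.
A brick of the near-critical arm-separation theorem for four arms of alternating colours
(P. Nolin, *Near-critical percolation in two dimensions*, EJP 13 (2008), Thm. 11 for `j = 4`,
`σ = BWBW` [arXiv 0711.4948: Thm. 10], internal extremities, §4.4 p. 13 "the reasoning is the same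
for internal extremities", uniformly in `p` below the characteristic length): four alternating arms
landed on the sides `0, 2, 3, 5` of `∂Λ_N` (`extFourArmQ n N`) can also be required to start,
`n/64`-separated, on the sides `0, 2, 3, 5` of `∂Λ_n`, at constant cost — up to the half-turn twist
of the inner landing (`sepFourArmG n N q`, `q ∈ {0, 3}`, `ArmSeparationInLandingFour`):

`P_p(extFourArmQ n N) ≤ C · (P_p(sepFourArmG n N 0) + P_p(sepFourArmG n N 3))`, `n ≥ n₀`, `2n ≤ N ≤ Ncap`,

at every `p` where the frame input and two RSW inputs hold at `p` and `1 - p` for boxes of size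
`≤ Ncap` (`exists_real_extFourArmQ_le_mul_sepFourArmG_at`). This is Nolin's multi-scale summation
read inward on the ladder `m_j = (n+1) 2^j - 1` (`ArmSeparationInScheme.inRad`), fed with the inward
step `real_extFourArmQ_le_step4_at` and `real_not_inGoodF_le_at` (`ArmSeparationIntSurgeryFour`),
the landing `real_intTinyExt4_le_at` of the rung `irung4` (`ArmSeparationInCoverFour`; tips at least
`16 μ` from the corners), the inward extension `real_sepFourArmG_mul_le_inward_at`
(`ArmSeparationInExtFour`) and the initial scale `pow_le_real_sepFourArmQ_at`
(`ArmSeparationSepInitFour`), through the finite-range scheme `le_mul_of_separationScheme_upto`.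
Everything here is proved; no named facts are introduced.

## References

* P. Nolin, Near-critical percolation in two dimensions, *Electron. J. Probab.* 13 (2008), §4.4,
  Thm. 11 and its proof, internal extremities (arXiv 0711.4948: Thm. 10, p. 13) [Nolin2008].
* H. Kesten, Scaling relations for 2D-percolation, *Comm. Math. Phys.* 109 (1987), Lemma 2 [Kesten1987].
-/

noncomputable section

open Set MeasureTheory

namespace Literature.Probability.Percolation

open LatticeModels

/-! ### The inner rung with tips `16 μ` from the corners -/

/-- **The parameter block of the four-arm inner rung** at radius `m`: target radius `n = (m-1)/2`,
smallest scale `k₀ = m / D`, `K` scales, tip margin `R₀ = 16 μ`. [cite: Nolin2008, §4.4 (arXiv 0711.4948: Thm. 10, internal extremities)] -/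
def irung4 (m N D K : ℕ) : LParams := ⟨m, (m - 1) / 2, N, m / D, K, 16 * trapScale (m / D) K⟩

/-- **The rung is valid** for `D ≥ 256 · 32^K`, `m` odd, `m ≥ 64 D`, `m ≥ 257`, `N ≥ 2m`, `K ≥ 1`. [folklore] -/
theorem irung4_rvalid {m N D K : ℕ} (hK : 1 ≤ K) (hD : 256 * 32 ^ K ≤ D) (hm : 64 * D ≤ m) (hodd : m % 2 = 1) (hm' : 257 ≤ m)
    (hN : 2 * m ≤ N) : (irung4 m N D K).RValid := by
  have hD1 : 1 ≤ D := by have h1 : 1 ≤ 32 ^ K := Nat.one_le_pow _ _ (by norm_num); omega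
  have hk : 64 ≤ m / D := (Nat.le_div_iff_mul_le (by omega)).2 (by linarith)
  have hμ : 256 * trapScale (m / D) K ≤ m := by
    unfold trapScale
    calc 256 * (m / D * 32 ^ K) = m / D * (256 * 32 ^ K) := by ring
      _ ≤ m / D * D := Nat.mul_le_mul_left _ hD
      _ ≤ m := Nat.div_mul_le_self m D
  refine ⟨?_, hK, ?_⟩
  · exact
      { hm := by show m = 2 * ((m - 1) / 2) + 1; omega
        hk₀ := hk
        hN := hN
        hn := by show 128 ≤ (m - 1) / 2; omega
        hμn := by show 64 * trapScale (m / D) K ≤ (m - 1) / 2; omega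
        hR₀ := by show 8 * trapScale (m / D) K ≤ 16 * trapScale (m / D) K; omega
        hR₀n := by show 4 * (16 * trapScale (m / D) K) ≤ (m - 1) / 2; omega }
  · show 16 * trapScale (m / D) K ≤ 16 * trapScale (m / D) K
    exact le_rfl

/-- Windows: `Nw ≤ 8 D`. [folklore] -/
theorem irung4_Nw_le {m N D K : ℕ} (hD1 : 1 ≤ D) (hm : 64 * D ≤ m) : (irung4 m N D K).Nw ≤ 8 * D := by
  have h : (irung4 m N D K).Nw = (rungParams m N D K).Nw := rfl
  rw [h]; exact Nw_le hD1 hm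

/-- Chunks of the outermost ring: `inL 0 ≤ 2 D`, so `iGr 0 ≤ 24 D`. [folklore] -/
theorem irung4_iGr0_le {m N D K : ℕ} (hD1 : 1 ≤ D) (hm : 64 * D ≤ m) : (irung4 m N D K).iGr 0 ≤ 24 * D := by
  have hk : 64 ≤ m / D := (Nat.le_div_iff_mul_le (by omega)).2 (by linarith)
  set k₀ := m / D with hk₀
  have hlt : m < D * (k₀ + 1) := by
    have := Nat.lt_div_mul_add (a := m) (show 0 < D by omega); rw [hk₀]; linarith [Nat.mul_comm (m / D) D]
  show 12 * (k₀ * ((m - (2 * 0 + 1) * (k₀ * 32 ^ K)) / k₀) / k₀) - 4 ≤ 24 * D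
  have hk0 : 0 < k₀ := by omega
  rw [Nat.mul_div_cancel_left _ hk0]
  have h1 : (m - (2 * 0 + 1) * (k₀ * 32 ^ K)) / k₀ ≤ m / k₀ := Nat.div_le_div_right (Nat.sub_le _ _)
  have h2 : m / k₀ < 2 * D := by
    rw [Nat.div_lt_iff_lt_mul hk0]
    calc m < D * (k₀ + 1) := hlt
      _ ≤ D * (2 * k₀) := Nat.mul_le_mul_left _ (by omega)
      _ = 2 * D * k₀ := by ring
  omega

/-- The spokes of the inner rung fit RSW at aspect ratio `256 · 32^K`: `iLL 7 + μ ≤ 256 · 32^K · (2ε)`. [folklore] -/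
theorem irung4_aspect7 {m N D K : ℕ} (hD : 256 * 32 ^ K ≤ D) (hm : 64 * D ≤ m) :
    (irung4 m N D K).iLL 7 + (irung4 m N D K).μ ≤ 256 * 32 ^ K * (2 * (irung4 m N D K).ε) := by
  have hX : 1 ≤ 32 ^ K := Nat.one_le_pow _ _ (by norm_num)
  have hD1 : 1 ≤ D := by omega
  have hk : 64 ≤ m / D := (Nat.le_div_iff_mul_le (by omega)).2 (by linarith)
  set k₀ := m / D with hk₀
  set X := 32 ^ K with hXd
  show (2 * 7 + 1) * (k₀ * X) + 2 * k₀ + 4 * (k₀ / 4) + k₀ * X ≤ 256 * X * (2 * (k₀ / 16))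
  have h4 : 4 * (k₀ / 4) ≤ k₀ := Nat.mul_div_le k₀ 4
  have h16 : k₀ ≤ 16 * (k₀ / 16) + 15 := by omega
  set f := k₀ / 16 with hf
  have hXf : X * k₀ ≤ 16 * (X * f) + 15 * X := by nlinarith
  have hkey : 480 * X + 3 * k₀ ≤ 16 * (X * k₀) := by nlinarith
  nlinarith

/-- **The slot count of the inner rung is bounded in terms of `D, K`**. [folklore] -/
theorem irung4_slots_le {m N D K : ℕ} (hD : 256 * 32 ^ K ≤ D) (hm : 64 * D ≤ m) :
    ((∏ q : Fin 7, inSlot4Bound (irung4 m N D K) q ^ 4) * 2 : ℕ) ≤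
      (6 * K * (8 * D) * 5 * 8 * (24 * D + 1) * (24 * D + 1)) ^ 4 * 2 := by
  set P : LParams := irung4 m N D K with hP
  have hD1 : 1 ≤ D := by have h1 : 1 ≤ 32 ^ K := Nat.one_le_pow _ _ (by norm_num); omega
  have hNw : P.Nw ≤ 8 * D := irung4_Nw_le (N := N) (K := K) hD1 hm
  have hG : P.iGr 0 ≤ 24 * D := irung4_iGr0_le (N := N) (K := K) hD1 hm
  apply Nat.mul_le_mul_right
  rw [Finset.prod_pow]
  apply Nat.pow_le_pow_left
  rw [Fin.prod_univ_seven]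
  show 6 * P.K * P.Nw * 5 * 8 * (P.iGr 0 + 1) * (P.iGr 0 + 1) ≤ 6 * K * (8 * D) * 5 * 8 * (24 * D + 1) * (24 * D + 1)
  have hK : P.K = K := rfl
  rw [hK]
  gcongr

/-- **The guards of the inner rung** for `D = 256 · 32^(K+Kg)`, `m ≥ 64 D`: with `k₀ = m / D`,
`μ = k₀ 32^K`, `R₀ = 16 μ`: `k₀ ≥ 64`; the fence scales are `< m / 64`; the good-tip scales
`trapScale R₀ i`, `i < Kg`, satisfy `32 · ≤ m`; `2 · trapScale k₀ j + 1 ≤ R₀`. [folklore] -/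
theorem irung4_guards {m D K Kg : ℕ} (hD : D = 256 * 32 ^ (K + Kg)) (hm : 64 * D ≤ m) :
    64 ≤ m / D ∧ (∀ j < K, 64 * trapScale (m / D) j < m) ∧
      (∀ i < Kg, 32 * trapScale (16 * trapScale (m / D) K) i ≤ m) ∧
      (∀ j < K, 2 * trapScale (m / D) j + 1 ≤ 16 * trapScale (m / D) K) ∧ 2 ≤ 16 * trapScale (m / D) K ∧
      256 * trapScale (m / D) K ≤ m := by
  have hXK : 1 ≤ 32 ^ K := Nat.one_le_pow _ _ (by norm_num)
  have hXg : 1 ≤ 32 ^ Kg := Nat.one_le_pow _ _ (by norm_num)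
  have hDK : 256 * 32 ^ K ≤ D := by rw [hD, pow_add]; exact Nat.mul_le_mul_left _ (Nat.le_mul_of_pos_right _ hXg)
  have hD1 : 1 ≤ D := le_trans hXK (le_trans (Nat.le_mul_of_pos_left _ (by norm_num)) hDK)
  have hk : 64 ≤ m / D := (Nat.le_div_iff_mul_le (by omega)).2 (by linarith)
  set k₀ := m / D with hk₀
  have hkD : D * k₀ ≤ m := by rw [hk₀, Nat.mul_comm]; exact Nat.div_mul_le_self m D
  have hts : ∀ j < K, 32 * trapScale k₀ j ≤ trapScale k₀ K := fun j hj => by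
    calc 32 * trapScale k₀ j = trapScale k₀ (j + 1) := (trapScale_succ _ _).symm
      _ ≤ trapScale k₀ K := trapScale_mono _ hj
  have hμ : trapScale k₀ K = k₀ * 32 ^ K := rfl
  have hDk : 256 * (k₀ * 32 ^ K) * 32 ^ Kg = D * k₀ := by rw [hD, pow_add]; ring
  have hμm : 256 * trapScale k₀ K ≤ m := by
    have h1 : 256 * (k₀ * 32 ^ K) ≤ 256 * (k₀ * 32 ^ K) * 32 ^ Kg := Nat.le_mul_of_pos_right _ (by positivity)
    rw [hμ]; omega
  have hμ1 : 1 ≤ trapScale k₀ K := by rw [hμ]; nlinarith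
  refine ⟨hk, fun j hj => ?_, fun i hi => ?_, fun j hj => ?_, by omega, hμm⟩
  · have := hts j hj; omega
  · -- `32 · 16 k₀ 32^K · 32^i ≤ 16 k₀ 32^(K+Kg) ≤ D k₀ ≤ m`
    have h1 : 32 * 32 ^ i ≤ 32 ^ Kg := by
      rw [← pow_succ']; exact Nat.pow_le_pow_right (by norm_num) hi
    unfold trapScale
    calc 32 * (16 * (k₀ * 32 ^ K) * 32 ^ i) = 16 * (k₀ * 32 ^ K) * (32 * 32 ^ i) := by ring
      _ ≤ 16 * (k₀ * 32 ^ K) * 32 ^ Kg := Nat.mul_le_mul_left _ h1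
      _ ≤ 256 * (k₀ * 32 ^ K) * 32 ^ Kg := Nat.mul_le_mul_right _ (by omega)
      _ ≤ m := by rw [hDk]; exact hkD
  · have := hts j hj; omega

/-! ### The internal half at `p` -/

/-- **The internal half of the four-arm separation theorem at `p`** (Nolin 2008, Thm. 11 for
`j = 4`, `σ = BWBW`, internal extremities, "uniformly in `p`"): for constants `c_F ∈ (0, 1]`
(frames) and `c ∈ (0, 1]` (RSW at aspect ratio `1024`) there is a number of scales `K`, and then for
every `c_L ∈ (0, 1]` (RSW at aspect ratio `256 · 32^K`, used only by the landing) there are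
`C > 0` and `n₀` such that at every parameter `p` at which the three inputs hold at `p` and at
`1 - p` for boxes of size `≤ Ncap`,
`P_p(extFourArmQ n N) ≤ C · (P_p(sepFourArmG n N 0) + P_p(sepFourArmG n N 3))` for all `n ≥ n₀`,
`2n ≤ N ≤ Ncap`. Nolin's induction of §4.4 read inward on the ladder `m_j = (n+1) 2^j - 1`
(`le_mul_of_separationScheme_upto`). [cite: Nolin2008, §4.4 Thm. 11 (arXiv 0711.4948: Thm. 10, p. 13), internal extremities; Kesten1987, Lemma 2] -/
theorem exists_real_extFourArmQ_le_mul_sepFourArmG_at {cF c : ℝ} (hcF : 0 < cF) (hcF1 : cF ≤ 1) (hc : 0 < c) (hc1 : c ≤ 1) :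
    ∃ K : ℕ, ∀ cL : ℝ, 0 < cL → cL ≤ 1 → ∃ C : ℝ, 0 < C ∧ ∃ n₀ : ℕ, ∀ (p : unitInterval) (Ncap : ℕ),
      (∀ q : unitInterval, (q = p ∨ q = unitInterval.symm p) →
        ∀ (z : Site 2) (k : ℕ), 1 ≤ k → k ≤ Ncap → cF ≤ (triSitePercolation q).real (triFrameAt z k)) →
      (∀ q : unitInterval, (q = p ∨ q = unitInterval.symm p) →
        ∀ k : ℕ, 1 ≤ ⌊((1024 : ℕ) : ℝ) * k⌋₊ → k ≤ Ncap → c ≤ triLRCrossingProb q ⌊((1024 : ℕ) : ℝ) * k⌋₊ k) →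
      (∀ q : unitInterval, (q = p ∨ q = unitInterval.symm p) →
        ∀ k : ℕ, 1 ≤ ⌊((256 * 32 ^ K : ℕ) : ℝ) * k⌋₊ → k ≤ Ncap → cL ≤ triLRCrossingProb q ⌊((256 * 32 ^ K : ℕ) : ℝ) * k⌋₊ k) →
      ∀ n N : ℕ, n₀ ≤ n → 2 * n ≤ N → N ≤ Ncap →
        (triSitePercolation p).real (extFourArmQ n N) ≤
          C * ((triSitePercolation p).real (sepFourArmG n N 0) + (triSitePercolation p).real (sepFourArmG n N 3)) := by
  -- the constants
  set a : ℝ := 1 - c ^ 5 with ha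
  set b : ℝ := 1 - cF ^ 2 with hb
  have hc5 : c ^ 5 ≤ 1 := pow_le_one₀ hc.le hc1
  have hc5' : 0 < c ^ 5 := by positivity
  have ha0 : 0 ≤ a := by rw [ha]; linarith
  have ha1 : a < 1 := by rw [ha]; linarith
  have hb0 : 0 ≤ b := by rw [hb]; linarith [pow_le_one₀ hcF.le hcF1 (n := 2)]
  have hb1 : b < 1 := by rw [hb]; linarith [pow_pos hcF 2]
  have hq93 : 0 < (c ^ 93) ^ 4 := by positivity
  set C₀ : ℝ := 1 / (c ^ 93) ^ 4 with hC₀def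
  have hC₀ : 1 ≤ C₀ := by
    rw [hC₀def, le_div_iff₀ hq93, one_mul]
    calc (c ^ 93) ^ 4 ≤ (1 : ℝ) ^ 4 := by gcongr; exact pow_le_one₀ hc.le hc1
      _ = 1 := one_pow 4
  have hC₀0 : 0 < C₀ := lt_of_lt_of_le one_pos hC₀
  obtain ⟨T, K, Kg, hK1, hsmall⟩ := exists_scheme_constants ha0 ha1 hb0 hb1 hC₀
  refine ⟨K, fun cL hcL hcL1 => ?_⟩
  set ε : ℝ := 12 * (a ^ (T + 1) + T * b ^ K + 2 * b ^ Kg) with hε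
  have hε0 : 0 ≤ ε := by positivity
  have hεC : ε * C₀ ^ 2 ≤ 1 / 2 := by rw [hε]; exact hsmall
  set D : ℕ := 256 * 32 ^ (K + Kg) with hD
  have hDK : 256 * 32 ^ K ≤ D := by
    rw [hD, pow_add]; exact Nat.mul_le_mul_left _ (Nat.le_mul_of_pos_right _ (Nat.one_le_pow _ _ (by norm_num)))
  have hD1 : 1 ≤ D := le_trans (Nat.one_le_pow K 32 (by norm_num)) (le_trans (Nat.le_mul_of_pos_left _ (by norm_num)) hDK)
  set ci : ℝ := (c ^ 5) ^ 4 with hci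
  have hci0 : 0 < ci := by positivity
  set Bg : ℕ := 24 * D with hBg
  set Nsl : ℕ := (6 * K * (8 * D) * 5 * 8 * (24 * D + 1) * (24 * D + 1)) ^ 4 * 2 with hNsl
  set qL : ℝ := (cF * cL ^ (Bg + 3)) ^ 4 with hqL
  have hqL0 : 0 < qL := by positivity
  set C₁ : ℝ := Nsl / qL with hC₁
  have hC₁0 : 0 ≤ C₁ := by positivity
  refine ⟨2 * C₁ + 1 / ci, by positivity, 64 * D + 1100, fun p Ncap hF hrsw hrswL n N hn hN hcapN => ?_⟩
  set μ := triSitePercolation p with hμ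
  have hP1 : ∀ s : Set (SiteConfig (Site 2)), μ.real s ≤ 1 := fun s => measureReal_le_one
  have hP0 : ∀ s : Set (SiteConfig (Site 2)), 0 ≤ μ.real s := fun s => measureReal_nonneg
  set hS : ℕ → ℝ := fun m => μ.real (sepFourArmG m N 0) + μ.real (sepFourArmG m N 3) with hhS
  have hS0 : ∀ m, 0 ≤ hS m := fun m => by simp only [hhS]; positivity
  have hCc : 1 / ci ≤ 2 * C₁ + 1 / ci := by linarith
  -- RSW inputs in usable forms
  have hfl : ∀ k : ℕ, ⌊((1024 : ℕ) : ℝ) * (k : ℕ)⌋₊ = 1024 * k := fun k => by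
    have : ((1024 : ℕ) : ℝ) * (k : ℕ) = ((1024 * k : ℕ) : ℝ) := by push_cast; ring
    rw [this, Nat.floor_natCast]
  have hcw24 : ∀ m, 8 ≤ m → m ≤ N → ∀ q : unitInterval, (q = p ∨ q = unitInterval.symm p) →
      ∀ L : ℕ, L ≤ 24 * (m / 8) → c ≤ triLRCrossingProb q L (m / 8) := fun m hm hmN q hq L hL => by
    have h := hrsw q hq (m / 8) (by rw [hfl]; omega) (by omega)
    rw [hfl] at h
    exact h.trans (triLRCrossingProb_anti_width q (by omega) _)
  have hinit : ∀ m N', 1100 ≤ m → 2 * m ≤ N' → N' ≤ 10 * m → N' ≤ Ncap → μ.real (sepFourArmG m N' 0) + μ.real (sepFourArmG m N' 3) ≥ ci ∧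
      ci ≤ μ.real (sepFourArmG m N' 0) := fun m N' h1 h2 h3 h4 => by
    have h := pow_le_real_sepFourArmQ_at p hrsw le_rfl hc.le h1 h2 h3 h4
    rw [← sepFourArmG_zero] at h
    have h3' : 0 ≤ μ.real (sepFourArmG m N' 3) := hP0 _
    exact ⟨by rw [hci]; linarith, h⟩
  by_cases h10 : N ≤ 10 * n
  · -- few scales: the initial estimate directly
    have h1 := (hinit n N (by omega) hN h10 hcapN).1
    calc μ.real (extFourArmQ n N) ≤ 1 := hP1 _
      _ ≤ 1 / ci * hS n := by rw [one_div_mul_eq_div, le_div_iff₀ hci0, one_mul]; exact h1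
      _ ≤ (2 * C₁ + 1 / ci) * hS n := mul_le_mul_of_nonneg_right hCc (hS0 n)
  push Not at h10
  -- the number of rungs
  have hn0 : 0 < n + 1 := Nat.succ_pos n
  set qq := (N + 2) / (n + 1) with hqq
  have hq8 : 8 ≤ qq := (Nat.le_div_iff_mul_le hn0).2 (by omega)
  obtain ⟨e, he1, he2⟩ : ∃ e, 2 ^ e ≤ qq ∧ qq < 2 ^ (e + 1) :=
    ⟨Nat.log 2 qq, Nat.pow_log_le_self 2 (by omega), Nat.lt_pow_succ_log_self one_lt_two _⟩
  have he3 : 3 ≤ e := by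
    by_contra h
    push Not at h
    have : 2 ^ (e + 1) ≤ 8 := by
      calc 2 ^ (e + 1) ≤ 2 ^ 3 := Nat.pow_le_pow_right (by norm_num) (by omega)
        _ = 8 := by norm_num
    omega
  obtain ⟨J, rfl⟩ : ∃ J, e = J + 1 := ⟨e - 1, by omega⟩
  obtain ⟨J', hJ'⟩ : ∃ J', J = J' + 1 := ⟨J - 1, by omega⟩
  have hX1 : (n + 1) * 2 ^ (J + 1) ≤ N + 2 := by
    have := (Nat.le_div_iff_mul_le hn0).1 he1; rw [Nat.mul_comm]; exact this
  have hX2 : N + 2 < (n + 1) * 2 ^ (J + 1 + 1) := by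
    have := (Nat.div_lt_iff_lt_mul hn0).1 he2; rw [Nat.mul_comm]; exact this
  -- the extreme rungs
  have h2mJ : 2 * inRad n J ≤ N := by have := two_mul_inRad n J; omega
  have hinitJ : N ≤ 10 * inRad n J' := by
    have h1 := two_mul_inRad n J'
    rw [← hJ'] at h1
    have h2 : (n + 1) * 2 ^ (J + 1 + 1) = 4 * ((n + 1) * 2 ^ J) := by rw [pow_succ, pow_succ]; ring
    have h3 := le_inRad n J'
    omega
  have hrad : ∀ i, i + 1 ≤ J → inRad n (J - i) = 2 * inRad n (J - (i + 1)) + 1 := fun i hi => by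
    rw [show J - i = J - (i + 1) + 1 by omega, inRad_succ]
  have hradJ : ∀ j, j ≤ J → 2 * inRad n j ≤ N := fun j hj => by have := inRad_mono n hj; omega
  have hodd : ∀ j, 1 ≤ j → inRad n j % 2 = 1 := fun j hj => by
    obtain ⟨j', rfl⟩ : ∃ j', j = j' + 1 := ⟨j - 1, by omega⟩
    rw [inRad_succ]; omega
  -- the scheme, read inward: index `i` ↦ radius `m_{J-i}`
  have key := le_mul_of_separationScheme_upto
    (f := fun i => μ.real (extFourArmQ (inRad n (J - i)) N))
    (g := fun i => μ.real (IntTinyExt4 (inRad n (J - i)) N (inRad n (J - i) / D) K (16 * trapScale (inRad n (J - i) / D) K)))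
    (h := fun i => hS (inRad n (J - i)))
    (k := 0) (L := J) (ε := ε) (C₀ := C₀) (C₁ := C₁) (c := ci) hε0 hC₀ hC₁0 hci0 hεC
    (fun _ => hP1 _) (fun i => hS0 _) (by omega)
    (fun i _ hiJ => ?_) (fun i _ hiJ => ?_) (fun i hi1 hiJ => ?_) (fun i hi1 hiJ => ?_) ?_ J (by omega) le_rfl
  · simpa only [Nat.sub_self, inRad_zero] using key
  · -- monotonicity in the inner radius
    show μ.real (extFourArmQ (inRad n (J - (i + 1))) N) ≤ μ.real (extFourArmQ (inRad n (J - i)) N)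
    refine measureReal_mono (extFourArmQ_mono (inRad_mono n (by omega)) ?_) (measure_ne_top _ _)
    have := hradJ (J - i) (by omega); omega
  · -- the inward step at the rung `m = m_{J-i-1}`, `2m+1 = m_{J-i}`
    set m := inRad n (J - (i + 1)) with hm
    show μ.real (extFourArmQ m N) ≤
        μ.real (IntTinyExt4 m N (m / D) K (16 * trapScale (m / D) K)) + ε * μ.real (extFourArmQ (inRad n (J - i)) N)
    rw [hrad i hiJ]
    have hmn : n ≤ m := le_inRad n _
    have hm2 : 2 * (2 * m + 1) ≤ N := by rw [← hrad i hiJ]; exact hradJ _ (by omega)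
    have hmN : m ≤ N := by omega
    have hmD : 64 * D ≤ m := by omega
    obtain ⟨gk, gKm, gRg, gKR, gR2, gμm⟩ := irung4_guards (K := K) (Kg := Kg) hD hmD
    set k₀ := m / D with hk₀'
    have step := real_extFourArmQ_le_step4_at p (m := m) (N := N) (T := T) (k₀ := k₀) (K := K)
      (R₀ := 16 * trapScale k₀ K) (Kg := Kg) (by omega) hm2 gR2 gKm gRg (fun i hi => by have := gRg i hi; omega)
    have hF' : ∀ q : unitInterval, (q = p ∨ q = unitInterval.symm p) →
        ∀ (z : Site 2) (k : ℕ), 1 ≤ k → k < Ncap + 1 → cF ≤ (triSitePercolation q).real (triFrameAt z k) :=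
      fun q hq z k hk hkS => hF q hq z k hk (by omega)
    have bound := real_not_inGoodF_le_at p (S := Ncap + 1) hcF hcF1 hF' (m := m) (by omega) (hcw24 m (by omega) hmN) hc.le
      (T := T) (k₀ := k₀) (K := K) (R₀ := 16 * trapScale k₀ K) (Kg := Kg) (by omega) (by omega) gKR
      (fun j hj => by have := gKm j hj; omega) (fun i hi => by have := gRg i hi; omega)
    rw [← ha, ← hb] at bound
    have hbad' : μ.real {ω | ¬ InGoodF m T k₀ K (16 * trapScale k₀ K) Kg ω} ≤ ε := by rw [hε]; exact bound
    have hE0 : 0 ≤ μ.real (extFourArmQ (2 * m + 1) N) := hP0 _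
    calc μ.real (extFourArmQ m N)
        ≤ μ.real (IntTinyExt4 m N k₀ K (16 * trapScale k₀ K)) +
            μ.real {ω | ¬ InGoodF m T k₀ K (16 * trapScale k₀ K) Kg ω} * μ.real (extFourArmQ (2 * m + 1) N) := step
      _ ≤ _ := add_le_add le_rfl (mul_le_mul_of_nonneg_right hbad' hE0)
  · -- the landing of the rung `m_{J-i}` onto `∂Λ_{m_{J-i-1}}`
    set m := inRad n (J - i) with hm
    show μ.real (IntTinyExt4 m N (m / D) K (16 * trapScale (m / D) K)) ≤ C₁ * hS (inRad n (J - (i + 1)))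
    have hmn : n ≤ m := le_inRad n _
    have hmD : 64 * D ≤ m := by omega
    have hmN2 : 2 * m ≤ N := hradJ _ (by omega)
    have hV := irung4_rvalid (N := N) hK1 hDK hmD (hodd (J - i) (by omega)) (by omega) hmN2
    have e2 : (m - 1) / 2 = inRad n (J - (i + 1)) := by rw [hm, hrad i hiJ]; omega
    have hcap : (irung4 m N D K).n / 8 ≤ Ncap := by show (m - 1) / 2 / 8 ≤ Ncap; omega
    have hland := real_intTinyExt4_le_at hV p hF hrswL (ρ := 256 * 32 ^ K) (by have := Nat.one_le_pow K 32 (by norm_num); omega)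
      hcL.le hcF.le (irung4_aspect7 (N := N) hDK hmD) hcap (irung4_iGr0_le (N := N) (K := K) hD1 hmD)
    have hslots := irung4_slots_le (N := N) (m := m) hDK hmD
    have hsl : (((∏ q : Fin 7, inSlot4Bound (irung4 m N D K) q ^ 4) * 2 : ℕ) : ℝ) ≤ (Nsl : ℝ) := by exact_mod_cast hslots
    have hE : (triSitePercolation p).real (sepFourArmG (irung4 m N D K).n (irung4 m N D K).N 0) +
        (triSitePercolation p).real (sepFourArmG (irung4 m N D K).n (irung4 m N D K).N 3) = hS (inRad n (J - (i + 1))) := by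
      show μ.real (sepFourArmG ((m - 1) / 2) N 0) + μ.real (sepFourArmG ((m - 1) / 2) N 3) = hS (inRad n (J - (i + 1)))
      rw [e2]
    rw [hE] at hland
    rw [hC₁, div_mul_eq_mul_div, le_div_iff₀ hqL0]
    calc μ.real (IntTinyExt4 m N (m / D) K (16 * trapScale (m / D) K)) * qL
        ≤ (((∏ q : Fin 7, inSlot4Bound (irung4 m N D K) q ^ 4) * 2 : ℕ) : ℝ) * hS (inRad n (J - (i + 1))) := hland
      _ ≤ (Nsl : ℝ) * hS (inRad n (J - (i + 1))) := mul_le_mul_of_nonneg_right hsl (hS0 _)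
  · -- the inward extension
    show hS (inRad n (J - i)) ≤ C₀ * hS (inRad n (J - (i + 1)))
    have h1 := le_inRad n (J - (i + 1))
    have hm' : 1100 ≤ inRad n (J - (i + 1)) := by omega
    have hmm : 2 * inRad n (J - (i + 1)) + 1 ≤ inRad n (J - i) := by rw [hrad i hiJ]
    have hm3 : inRad n (J - i) ≤ 3 * inRad n (J - (i + 1)) := by rw [hrad i hiJ]; omega
    have hNN : 2 * inRad n (J - i) ≤ N := hradJ _ (by omega)
    have hcap : inRad n (J - i) ≤ Ncap := by omega
    have x0 := real_sepFourArmG_mul_le_inward_at p hrsw (by norm_num) hc.le (q := 0) (by norm_num) hm' hmm hm3 hNN hcap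
    have x3 := real_sepFourArmG_mul_le_inward_at p hrsw (by norm_num) hc.le (q := 3) (by norm_num) hm' hmm hm3 hNN hcap
    simp only [hhS]
    rw [hC₀def, one_div, ← div_eq_inv_mul, le_div_iff₀ hq93, add_mul]
    exact add_le_add x0 x3
  · -- the initial scale `m_{J-1}`
    show ci ≤ hS (inRad n (J - (0 + 1)))
    rw [show J - (0 + 1) = J' by omega]
    exact (hinit (inRad n J') N (by have := le_inRad n J'; omega) (hradJ _ (by omega)) hinitJ hcapN).1

end Literature.Probability.Percolation
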